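import Literature.MathematicalPhysics.QuantumFieldTheory.Balaban1983to89.B6Dg288ChartV1
import Literature.MathematicalPhysics.QuantumFieldTheory.Balaban1983to89.B6Eq2129TwoScaleV1
import Literature.MathematicalPhysics.QuantumFieldTheory.Balaban1983to89.B6V1TorusWitness

/-!
# `Balaban1983to89.B6MemberTorusTDomainsV1` — T. Bałaban, *Propagators and renormalization transformations for lattice gauge theories. II*,
# Commun. Math. Phys. **96** (1984) 223–250 [Balaban1984PropagatorsII], p. 238–239 (the member torus `T_□`, (2.89)–(2.90)) READ AS A
# (2.1)–(2.2) FAMILY OF p21's TORUS LINEAGE: **the two-scale member of a cube is a `TDomains d ℓ M_h (j+1) P R` with the two ADJACENT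
# levels `j`, `j+1`** — (2.2) is VOID for adjacent levels, (2.1) holds as soon as `B^j(Λ′)` is a union of big `(j+1)`-blocks — so that EVERY
# theorem of the torus lineage (Prop. 2.2 (2.67), Prop. 2.3 (2.87), (2.88), `G′Δ′_a = 1`, the five-factor `P = G′Q′*(Q′G′²Q′*)⁻¹Q′G′`)
# holds for the member WITH THE CONSTANTS OF THE GLOBAL TORUS; and its V1 reading: r03's `domT` of this family IS the two-scale datum
# `twoScale j hj Λ′` of Sect. C, hence the member's `R`/`P`/`∂P∂*` of `tsV1` are p21's torus matrices `rM`/`pM` read through the chart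

statement-level skeleton of published theorems with citation tags; proofs where landed; nothing here is a claim about the Yang–Mills mass gap

PDF held: `paper:balaban1984-cmp96-propagators-rt-ii` (journal page = PDF page + 222); p. 224 [PDF 2] ((2.1)–(2.2)), p. 238–239 [PDF 16–17]
(T_□, (2.89)–(2.92)) re-read from the materialised text `~/.lit/texts/paper-balaban1984-cmp96-propagators-rt-ii/p0002.txt`, `p0016.txt`,
`p0017.txt` (this seat, 2026-08-23).

PRINT (verbatim up to notation).  p. 224: *"We consider a sequence of domains Ω₁ ⊃ Ω₂ ⊃ … ⊃ Ω_k, Ω_j ⊂ T_η (2.1) which satisfy the following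
conditions: Ω_j = B^j(Ω_j^{(j)}), Ω_j^{(j)} ⊂ T^{(j)}_{L^jη} and it is a sum of big blocks, (L^jη)^{−1}dist(Ω_j^c, Ω_{j+1}) > RM … (2.2) … we admit
the case when some domains Ω_j are equal to T_η"*.  p. 238–239: *"We take the cube □̃³ and identify it with a torus, denoted by T_□, imposing
periodicity conditions. On this torus we define operators R, Δ_a as in (2.17), (2.19), but only two scales are present now. We define B^j(Λ′) =
□̃² ∩ B^{j+1}(Λ_{j+1}), (2.89) and we take Q′*aQ′, Q*aQ equal to Q′_{j+1}*a_{j+1}Q′_{j+1}, Q_{j+1}*aL^{d−2}Q_{j+1} on B^j(Λ′), and to Q′_j*a_jQ′_j,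
Q_j*aQ_j on T_□ ∖ B^j(Λ′). Let us denote by P_□ the projection operator in (2.17) defined by the above Q′*aQ′, and G_□ = (Δ − ∂P_□∂* +
Q*aQ)⁻¹. (2.90)"*; p. 239: *"These operators were thoroughly investigated in paper [4] … We will prove that in the general case the operator G_□
has the same properties."*

CITATION HEADER (lean-in-tree rule) — WHAT IS REPRODUCED.  Phase-2 file of the `lit-balaban` typed skeleton (HOME `run/shared/lean/pub/lit-balaban/`),
seat **p22 gen 20** (free-target protocol G.5-34(d): TAKING line HOME/STATUS.md 2026-08-23T04:33Z, «(d4-iii) the concrete scalar factors of (2.92)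
line 3», design (b) «member torus as a p21 family»; B6 fold owner r03, referee ref-4); SKELETON rows **B6.Eq2.89** / **B6.Eq2.90** × **B6.Eq2.1** ×
**B6.Eq2.17** × **B6.Eq2.88** (cells only; no decl of record touched).  WHY: the `k`-level Proposition 2.6 assembly (ROUTE V, B6-CLOSURE.md §5
items 7–13) needs, for line 3 `ζ_□(∂P∂* − ∂P_□∂*)h_□` of (2.92) (p38's `B6DomainChangeP2134` + sizes), (2.67)/(2.87)-shape majorants of the
MEMBER's scalar factors `G′_□`, `(Q′G′_□²Q′*)⁻¹`; the Sect. C lane (`tsV1`, `Λ′` arbitrary) has none, while p21's torus lineage proves all of them for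
every `TDomains` — THIS FILE puts the member torus into that lineage.
* §1 **`twoLevelT ℓ M_h j P R hj ΛB : TDomains d ℓ M_h (j+1) P R`** — level `j+1` on the big `(j+1)`-blocks whose label lies in `ΛB`, level `j`
  elsewhere: `one_le_lev`/`lev_le` trivial, **(2.1) `bigBlocks` by construction** (the level is a function of the big `(j+1)`-block), **(2.2)
  `sepT` VOID** (`lev x < i`, `i + 1 ≤ lev x′ ≤ j + 1` force `i ≤ j ≤ lev x`) — for EVERY `R`; `lev_eq_or`, `j_le_lev`, `succ_le_lev_iff`.
* §2 the V1 reading: `bigLab` (the big-block label `⌊Y/(M_h·L)⌋` of a V1 block), `LamV1 M_h ΛB` (the `(j+1)`-blocks of the member torus whose big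
  block is in `ΛB`), `blk_bigSide_toBox` (`blk (M_h·L^{j+2}) (toBox x) = bigLab (y^{j+1}(x))`), **`domT_twoLevelT`**: `domT hN (twoLevelT …) hk =
  twoScale j hk (LamV1 M_h ΛB)` — r03's V1 domain datum of the family IS the two-scale datum of Sect. C (`Ω_i = T` for `i ≤ j`, `Ω_{j+1} = Λ′`);
  `LamV1_image`/`LamV1_sat`/**`domT_twoLevelT_of_sat`** (every big-block-SATURATED `Λ′` — `hsat`: membership depends only on `bigLab` — is a
  `LamV1`, so `domT hN (famOf … Λ′) hk = twoScale j hk Λ′` with `famOf … Λ′ := twoLevelT … (bigLab″Λ′)`).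
* §3 **the member's projection is p21's torus matrix** (every saturated `Λ′`, every weight `w`): `RE_twoScale_eq_rM_chart` (`RE (twoScale j hk Λ′) c
  f x = (rM D_□·(f∘chart⁻¹))(toBox x)`, `D_□ = famOf … Λ′`), **`tsV1_R_chart`** / **`tsV1_P_chart`** (`(tsV1 hc Λ′ w).R`/`.P` = `rM D_□`/`pM D_□ =
  G′Q′*(Q′G′²Q′*)⁻¹Q′G′` read through the chart, via `B6Eq2129TwoScaleV1.R_eq` + gen 19's `B6Dg288ChartV1.RE_eq_rM_chart`), and
  **`hasMajorant_gradPdv_member`**: (2.88) for the member's `∂P_□∂* = onFun (dE c ∘ (tsV1 …).P ∘ dsE c)` on `geomT D_□` WITH THE GLOBAL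
  CONSTANTS `(M₃, δ₂, C)` of `B6Dg288ChartV1.hasMajorant_Dg_V1`.
* §4 non-vacuity: `N0_member` (member torus sizes meeting `hN`: `M_h = L^a`, `P = 2L^b`, `m_t + K_t = j + 2 + a + b`), `member_nonvacuous`
  (the joint hypothesis set `hN`, `j + 1 ≤ m_t + K_t`, `1 ≤ M_h`, `4 ≤ P_μ`, both levels inhabited, is satisfiable for every `j ≥ 1`, `a`, `b ≥ 1`).
THEOREMS + transparent definitions with bodies (`twoLevelT`, `bigLab`, `LamV1`, `famOf`; no `def … : Prop`, no hypothesis-fact); standard axioms; imports BY NAME.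

HONEST SCOPE / DIVERGENCES. (1) Print's member torus is `□̃³` with `B^j(Λ′) = □̃² ∩ B^{j+1}(Λ_{j+1})`, a union of big `j`-blocks; HERE `B^j(Λ′)`
must be a union of big `(j+1)`-blocks of the member torus (the (2.1) clause of p21's structure at level `j+1`) — met by the (d5-b) members when the
window corner and period are multiples of `M_h·L^{j+2}` (then `Ω_{j+1} ∩ window`, big-block saturated by the global `TDomains.bigBlocks`, is
saturated in member coordinates); this is a RESTRICTION on the choice of windows, not on print's statement, recorded for the fold owner. (2) Print does
NOT claim that `T_□` satisfies (2.1)–(2.2) (p. 239 «we will have to modify some arguments»); that the two ADJACENT levels make (2.2) void is an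
observation of this file, used to IMPORT p21's torus theorems for the member — an honest route, not print's Sect. C argument. (3) Lattice units of the
member torus / V1 fine factor `c` as in gen 19's dictionary; the identification of §3 is weight-free (`R` is the orthogonal projection onto `ΔN(Q′)`).
(4) Nothing here is an estimate: §3's (2.88) is p21's `ineq288_multiLevelTorus` + gen 19's bridge applied to `D_□`.  NOT summit progress.
Unit `lit-balaban-p22` (gen 20), 2026-08-23.
-/

noncomputable section

open scoped Matrix
open Finset

namespace Literature.MathematicalPhysics.QuantumFieldTheory.Balaban1983to89.B6MemberTorusTDomainsV1

open B4Reflection242 (boxDom mem_boxDom blk)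
open B6MultiLevelBoxOperator (N0 bigSide one_le_bigSide)
open B6MultiLevelTorusOperator (TDomains N0_eq_bigSide_mul)
open B6LowerBound2153Torus (rep)
open B5Eq117TorusCarriers (Mk)
open B5Eq118OneStroke (iterBlockOf)
open B6Geom246MultiLevelTorus (geomT)
open B6RandomWalk (HasMajorant)
open B6Ineq2133TwoScaleV1 (onFun)
open B6SectAOperatorsV1 (ScalarSpace dE dsE RE)
open B6SectADomainsV1 (Domains)
open B6SectCTwoScaleV1 (twoScale CIdx)
open B6SectCTwoScaleV1Lattice (tsV1)
open B6GlobalChartV1 (PV toBox boxEquiv blkV1 domT blk_toBox)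
open B6ScalarChartV1 (exists_iterBlockOf_eq)
open B6Dg288ChartV1 (RE_eq_rM_chart hasMajorant_Dg_V1)
open B6Ineq288MultiLevelTorus (rM pM one_sub_rM)

variable {d : ℕ}

/-! ## §1  The member torus as a (2.1)–(2.2) family with two adjacent levels -/

section TwoLevel

variable {ℓ Mh j : ℕ} {P : Fin (d + 1) → ℕ} {R : ℕ}

/-- **THE MEMBER TORUS `T_□` AS A NESTED FAMILY OF p21's TORUS LINEAGE**: levels `j` and `j + 1` only — `Ω₁ = … = Ω_j = T_□`,
`Ω_{j+1} = B^j(Λ′)` = the union of the big `(j+1)`-blocks (side `M_h·L^{j+2}`) whose label lies in `ΛB`; (2.1) holds by construction and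
(2.2) is void (no pair of levels `i < i + 1` with `Ω_i ≠ T_□`), for every `R`. [cite: Balaban1984PropagatorsII, (2.1)–(2.2) p.224 («we admit the case when some domains Ω_j are equal to T_η»), (2.89)–(2.90) p.239 («only two scales are present now»)] -/
def twoLevelT (ℓ Mh j : ℕ) (P : Fin (d + 1) → ℕ) (R : ℕ) (hj : 1 ≤ j) (ΛB : Finset (Fin (d + 1) → ℤ)) :
    TDomains d ℓ Mh (j + 1) P R where
  lev z := if blk (bigSide ℓ Mh (j + 1)) z ∈ ΛB then j + 1 else j
  one_le_lev z := by split_ifs <;> omega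
  lev_le z := by split_ifs <;> omega
  bigBlocks i hi x _ x' _ hblk := by
    by_cases hij : i ≤ j
    · constructor <;> intro _ <;> split_ifs <;> omega
    by_cases hi1 : i = j + 1
    · subst hi1
      rw [hblk]
    · constructor <;> intro h <;> split_ifs at h <;> omega
  sepT i x _ x' _ h1 h2 := by
    exfalso
    split_ifs at h1 h2 <;> omega

/-- the level function of the member family. [cite: Balaban1984PropagatorsII, (2.89) p.239, dictionary] -/
@[simp] theorem twoLevelT_lev (hj : 1 ≤ j) (ΛB : Finset (Fin (d + 1) → ℤ)) (z : Fin (d + 1) → ℤ) :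
    (twoLevelT ℓ Mh j P R hj ΛB).lev z = if blk (bigSide ℓ Mh (j + 1)) z ∈ ΛB then j + 1 else j := rfl

/-- every site of the member torus has level `j` or `j + 1` (*"only two scales are present now"*). [cite: Balaban1984PropagatorsII, p.239] -/
theorem lev_eq_or (hj : 1 ≤ j) (ΛB : Finset (Fin (d + 1) → ℤ)) (z : Fin (d + 1) → ℤ) :
    (twoLevelT ℓ Mh j P R hj ΛB).lev z = j ∨ (twoLevelT ℓ Mh j P R hj ΛB).lev z = j + 1 := by
  rw [twoLevelT_lev]; split_ifs
  · exact Or.inr rfl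
  · exact Or.inl rfl

/-- every site has level `≥ j` (`Ω_j = T_□`). [cite: Balaban1984PropagatorsII, (2.89) p.239] -/
theorem j_le_lev (hj : 1 ≤ j) (ΛB : Finset (Fin (d + 1) → ℤ)) (z : Fin (d + 1) → ℤ) : j ≤ (twoLevelT ℓ Mh j P R hj ΛB).lev z := by
  rcases lev_eq_or (P := P) (R := R) (ℓ := ℓ) (Mh := Mh) hj ΛB z with h | h <;> omega

/-- `x ∈ Ω_{j+1} = B^j(Λ′)` iff the big `(j+1)`-block of `x` is listed. [cite: Balaban1984PropagatorsII, (2.89) p.239] -/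
theorem succ_le_lev_iff (hj : 1 ≤ j) (ΛB : Finset (Fin (d + 1) → ℤ)) (z : Fin (d + 1) → ℤ) :
    j + 1 ≤ (twoLevelT ℓ Mh j P R hj ΛB).lev z ↔ blk (bigSide ℓ Mh (j + 1)) z ∈ ΛB := by
  rw [twoLevelT_lev]; split_ifs with h
  · simp [h]
  · simp only [h, iff_false, not_le]; omega

end TwoLevel

/-! ## §2  The V1 reading: r03's `domT` of the member family is the two-scale datum of Sect. C -/

section V1

variable {ℓ : ℕ} {mt Kt : ℕ} {hd : 1 ≤ d + 1} {hL : Odd (ℓ + 1) ∧ 1 < ℓ + 1}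

/-- the big-block label `⌊Y_μ/(M_h·L)⌋` of a block `Y` of the member torus (big blocks = `M = M_h·L` blocks per side).
[cite: Balaban1984PropagatorsII, (2.1) p.224 («a sum of big blocks»), dictionary] -/
def bigLab (Mh : ℕ) {n : ℕ} (Y : Site (PV d ℓ mt Kt hd hL) n) : Fin (d + 1) → ℤ :=
  blk (Mh * (ℓ + 1)) (rep (Mk (PV d ℓ mt Kt hd hL) n) Y)

/-- **`Λ′` of the member as a set of V1 `(j+1)`-blocks**: the blocks whose big block is listed in `ΛB`.
[cite: Balaban1984PropagatorsII, (2.89) p.239] -/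
def LamV1 (Mh : ℕ) {n : ℕ} (ΛB : Finset (Fin (d + 1) → ℤ)) : Finset (Site (PV d ℓ mt Kt hd hL) n) :=
  Finset.univ.filter fun Y => bigLab Mh Y ∈ ΛB

/-- membership in `LamV1`. [cite: Balaban1984PropagatorsII, (2.89) p.239, dictionary] -/
@[simp] theorem mem_LamV1 (Mh : ℕ) {n : ℕ} (ΛB : Finset (Fin (d + 1) → ℤ)) (Y : Site (PV d ℓ mt Kt hd hL) n) :
    Y ∈ LamV1 Mh ΛB ↔ bigLab Mh Y ∈ ΛB := by
  simp [LamV1]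

/-- nested block labels: `⌊⌊z/a⌋/b⌋ = ⌊z/(ab)⌋`. [folklore] -/
private theorem blk_blk (a b : ℕ) (z : Fin (d + 1) → ℤ) : blk b (blk a z) = blk (a * b) z := by
  funext μ
  simp only [blk]
  push_cast
  exact Int.ediv_ediv_of_nonneg (Int.natCast_nonneg a)

/-- **big `(j+1)`-blocks of the chart point = big blocks of the V1 `(j+1)`-block**: `blk (M_h·L^{j+2}) (toBox x) = bigLab (y^{j+1}(x))`.
[cite: Balaban1984PropagatorsII, (2.1) p.224, dictionary] -/
theorem blk_bigSide_toBox {Mh k : ℕ} {P' : Fin (d + 1) → ℕ} (hN : ∀ μ, N0 ℓ Mh k P' μ = (PV d ℓ mt Kt hd hL).sitesPerDir 0)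
    {n : ℕ} (hn : n ≤ mt + Kt) (x : Site (PV d ℓ mt Kt hd hL) 0) :
    blk (bigSide ℓ Mh n) (toBox hN x : Fin (d + 1) → ℤ) = bigLab Mh (iterBlockOf n x) := by
  have e : bigSide ℓ Mh n = (ℓ + 1) ^ n * (Mh * (ℓ + 1)) := by unfold bigSide; ring
  rw [e, ← blk_blk, blk_toBox hN hn x]
  rfl

/-- two `Domains` data with the same `k` and the same `Ω`'s are equal. [folklore] -/
private theorem domains_ext {P : Params} {D₁ D₂ : Domains P} (hk : D₁.k = D₂.k) (hOm : D₁.Om = D₂.Om) : D₁ = D₂ := by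
  cases D₁; cases D₂; cases hk; cases hOm; rfl

variable {Mh : ℕ} {P' : Fin (d + 1) → ℕ} {R : ℕ} {j : ℕ}

/-- **r03's V1 DOMAIN DATUM OF THE MEMBER FAMILY IS THE TWO-SCALE DATUM OF SECT. C**: `domT hN (twoLevelT …) hk = twoScale j hk (LamV1 M_h ΛB)` —
`Ω_i^{(i)} = T^{(i)}` for `i ≤ j` (every site has level `≥ j`), `Ω_{j+1}^{(j+1)} = Λ′` (the `(j+1)`-blocks all of whose sites have level `j+1` are
exactly those whose big block is listed), nothing above. [cite: Balaban1984PropagatorsII, (2.89) p.239, (2.1) p.224] -/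
theorem domT_twoLevelT (hN : ∀ μ, N0 ℓ Mh (j + 1) P' μ = (PV d ℓ mt Kt hd hL).sitesPerDir 0) (hk : j + 1 ≤ mt + Kt) (hj : 1 ≤ j)
    (ΛB : Finset (Fin (d + 1) → ℤ)) :
    domT hN (twoLevelT ℓ Mh j P' R hj ΛB) hk = twoScale j hk (LamV1 Mh ΛB) := by
  classical
  refine domains_ext rfl ?_
  funext i
  by_cases hi0 : i = 0
  · subst hi0
    simp [domT, twoScale]
  by_cases hij : i ≤ j
  · -- `Ω_i = T` on both sides
    have hik : i ≤ j + 1 := by omega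
    rw [B6SectCTwoScaleV1.twoScale.Om_of_le hij]
    simp only [domT, hi0, if_false, hik, if_true]
    refine Finset.filter_true_of_mem fun y _ x _ => ?_
    exact le_trans hij (j_le_lev hj ΛB _)
  by_cases hi1 : i = j + 1
  · subst hi1
    rw [B6SectCTwoScaleV1.twoScale.Om_succ]
    simp only [domT, hi0, if_false, le_refl, if_true]
    ext Y
    simp only [Finset.mem_filter, Finset.mem_univ, true_and, mem_LamV1]
    constructor
    · intro h
      obtain ⟨x, hx⟩ := exists_iterBlockOf_eq hk Y
      have h1 := h x hx
      rw [succ_le_lev_iff, blk_bigSide_toBox hN hk, hx] at h1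
      exact h1
    · intro h x hx
      rw [succ_le_lev_iff, blk_bigSide_toBox hN hk, hx]
      exact h
  · -- above `j + 1`: `∅` on both sides
    have hgt : j + 1 < i := by omega
    rw [(twoScale j hk (LamV1 (hd := hd) (hL := hL) (mt := mt) (Kt := Kt) Mh ΛB)).Om_eq_empty (show (twoScale j hk _).k < i from hgt)]
    have hik : ¬ i ≤ j + 1 := by omega
    simp [domT, hi0, hik]

/-- **EVERY BIG-BLOCK-SATURATED `Λ′` IS A `LamV1`**: if membership in `Λ′` depends only on the big block, `Λ′ = LamV1 (bigLab '' Λ′)`.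
[cite: Balaban1984PropagatorsII, (2.1) p.224 («a sum of big blocks»), (2.89) p.239] -/
theorem LamV1_image {n : ℕ} (Λ' : Finset (Site (PV d ℓ mt Kt hd hL) n))
    (hsat : ∀ Y Y' : Site (PV d ℓ mt Kt hd hL) n, bigLab Mh Y = bigLab Mh Y' → (Y ∈ Λ' ↔ Y' ∈ Λ')) :
    LamV1 Mh (Λ'.image (bigLab Mh)) = Λ' := by
  classical
  ext Y
  rw [mem_LamV1, Finset.mem_image]
  constructor
  · rintro ⟨Y', hY', hlab⟩
    exact (hsat Y' Y hlab).1 hY'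
  · intro hY
    exact ⟨Y, hY, rfl⟩

/-- `LamV1` is big-block saturated. [cite: Balaban1984PropagatorsII, (2.1) p.224 («a sum of big blocks»), dictionary] -/
theorem LamV1_sat {n : ℕ} (ΛB : Finset (Fin (d + 1) → ℤ)) (Y Y' : Site (PV d ℓ mt Kt hd hL) n) (h : bigLab Mh Y = bigLab Mh Y') :
    Y ∈ LamV1 Mh ΛB ↔ Y' ∈ LamV1 Mh ΛB := by
  rw [mem_LamV1, mem_LamV1, h]

/-- **THE SAME FOR AN ARBITRARY BIG-BLOCK-SATURATED `Λ′`** (the form the (d5-b) members come in): with `ΛB := bigLab″Λ′`,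
`domT hN (twoLevelT … ΛB) hk = twoScale j hk Λ′`. [cite: Balaban1984PropagatorsII, (2.89) p.239, (2.1) p.224] -/
theorem domT_twoLevelT_of_sat (hN : ∀ μ, N0 ℓ Mh (j + 1) P' μ = (PV d ℓ mt Kt hd hL).sitesPerDir 0) (hk : j + 1 ≤ mt + Kt) (hj : 1 ≤ j)
    (Λ' : Finset (Site (PV d ℓ mt Kt hd hL) (j + 1)))
    (hsat : ∀ Y Y' : Site (PV d ℓ mt Kt hd hL) (j + 1), bigLab Mh Y = bigLab Mh Y' → (Y ∈ Λ' ↔ Y' ∈ Λ')) :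
    domT hN (twoLevelT ℓ Mh j P' R hj (Λ'.image (bigLab Mh))) hk = twoScale j hk Λ' := by
  rw [domT_twoLevelT hN hk hj, LamV1_image Λ' hsat]

end V1

/-! ## §3  The member's `R`, `P`, `∂P∂*` of Sect. C are p21's torus matrices of the member family -/

section Projection

variable {ℓ : ℕ} {mt Kt : ℕ} {hd : 1 ≤ d + 1} {hL : Odd (ℓ + 1) ∧ 1 < ℓ + 1}
variable {Mh : ℕ} {P' : Fin (d + 1) → ℕ} {R : ℕ} {j : ℕ}

/-- **THE MEMBER FAMILY OF A BIG-BLOCK-SATURATED `Λ′ ⊂ T^{(j+1)}`**: levels `j + 1` on `B^j(Λ′)`, `j` elsewhere (an abbreviation for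
`twoLevelT` at `ΛB := bigLab″Λ′`). [cite: Balaban1984PropagatorsII, (2.89)–(2.90) p.239] -/
abbrev famOf (Mh j : ℕ) (P' : Fin (d + 1) → ℕ) (R : ℕ) (hj : 1 ≤ j) (Λ' : Finset (Site (PV d ℓ mt Kt hd hL) (j + 1))) :
    TDomains d ℓ Mh (j + 1) P' R :=
  twoLevelT ℓ Mh j P' R hj (Λ'.image (bigLab Mh))

/-- **THE TWO-SCALE `R` (orthogonal projection onto `ΔN(Q′)`, (2.10)/(2.17)) OF THE V1 FAMILY `twoScale j hk Λ′` IS p21's TORUS `1 − P` OF THE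
MEMBER FAMILY**, read through the chart — for every big-block-saturated `Λ′`. [cite: Balaban1984PropagatorsII, (2.17) p.225, p.239 («R … as in (2.17) … only two scales are present now»)] -/
theorem RE_twoScale_eq_rM_chart (hN : ∀ μ, N0 ℓ Mh (j + 1) P' μ = (PV d ℓ mt Kt hd hL).sitesPerDir 0) (hk : j + 1 ≤ mt + Kt) (hj : 1 ≤ j)
    (Λ' : Finset (Site (PV d ℓ mt Kt hd hL) (j + 1)))
    (hsat : ∀ Y Y' : Site (PV d ℓ mt Kt hd hL) (j + 1), bigLab Mh Y = bigLab Mh Y' → (Y ∈ Λ' ↔ Y' ∈ Λ'))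
    (hMh : 1 ≤ Mh) (hP : ∀ μ, 1 ≤ P' μ) {c : ℝ} (hc : c ≠ 0)
    (f : ScalarSpace (PV d ℓ mt Kt hd hL)) (x : Site (PV d ℓ mt Kt hd hL) 0) :
    RE (twoScale j hk Λ') c f x = (rM (famOf Mh j P' R hj Λ') *ᵥ fun z => f ((boxEquiv hN).symm z)) (toBox hN x) := by
  have hℓ : 1 ≤ ℓ := by have := hL.2; omega
  rw [← domT_twoLevelT_of_sat hN hk hj Λ' hsat]
  exact RE_eq_rM_chart hN _ hk hℓ hMh hP hc f x

/-- **THE `R` OF THE SECT. C DATA `tsV1` IS p21's TORUS `1 − P` OF THE MEMBER FAMILY** (`B6Eq2129TwoScaleV1.R_eq` + the previous theorem), every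
big-block-saturated `Λ′`, every weight `w`. [cite: Balaban1984PropagatorsII, (2.17) p.225, (2.90) p.239] -/
theorem tsV1_R_chart (hN : ∀ μ, N0 ℓ Mh (j + 1) P' μ = (PV d ℓ mt Kt hd hL).sitesPerDir 0) (hk : j + 1 ≤ mt + Kt) (hj : 1 ≤ j)
    (Λ' : Finset (Site (PV d ℓ mt Kt hd hL) (j + 1)))
    (hsat : ∀ Y Y' : Site (PV d ℓ mt Kt hd hL) (j + 1), bigLab Mh Y = bigLab Mh Y' → (Y ∈ Λ' ↔ Y' ∈ Λ'))
    (hMh : 1 ≤ Mh) (hP : ∀ μ, 1 ≤ P' μ) {c : ℝ} (hc : c ≠ 0) (w : CIdx j Λ' → ℝ)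
    (f : ScalarSpace (PV d ℓ mt Kt hd hL)) (x : Site (PV d ℓ mt Kt hd hL) 0) :
    (tsV1 hc Λ' w).R f x = (rM (famOf Mh j P' R hj Λ') *ᵥ fun z => f ((boxEquiv hN).symm z)) (toBox hN x) := by
  rw [B6Eq2129TwoScaleV1.R_eq hc hk Λ' (w := w)]
  exact RE_twoScale_eq_rM_chart hN hk hj Λ' hsat hMh hP hc f x

/-- **THE `P = I − R` OF `tsV1` IS p21's FIVE-FACTOR TORUS MATRIX `pM = G′Q′*(Q′G′²Q′*)⁻¹Q′G′` OF THE MEMBER FAMILY** read through the chart.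
[cite: Balaban1984PropagatorsII, (2.17) p.225 («Rf = … (I − G′Q′*(Q′G′²Q′*)⁻¹Q′G′)f»), (2.90) p.239] -/
theorem tsV1_P_chart (hN : ∀ μ, N0 ℓ Mh (j + 1) P' μ = (PV d ℓ mt Kt hd hL).sitesPerDir 0) (hk : j + 1 ≤ mt + Kt) (hj : 1 ≤ j)
    (Λ' : Finset (Site (PV d ℓ mt Kt hd hL) (j + 1)))
    (hsat : ∀ Y Y' : Site (PV d ℓ mt Kt hd hL) (j + 1), bigLab Mh Y = bigLab Mh Y' → (Y ∈ Λ' ↔ Y' ∈ Λ'))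
    (hMh : 1 ≤ Mh) (hP : ∀ μ, 1 ≤ P' μ) {c : ℝ} (hc : c ≠ 0) (w : CIdx j Λ' → ℝ)
    (f : ScalarSpace (PV d ℓ mt Kt hd hL)) (x : Site (PV d ℓ mt Kt hd hL) 0) :
    (tsV1 hc Λ' w).P f x = (pM (famOf Mh j P' R hj Λ') *ᵥ fun z => f ((boxEquiv hN).symm z)) (toBox hN x) := by
  have eP : (tsV1 hc Λ' w).P = LinearMap.id - (tsV1 hc Λ' w).R := rfl
  rw [← one_sub_rM, Matrix.sub_mulVec, Matrix.one_mulVec, Pi.sub_apply, eP, LinearMap.sub_apply,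
    LinearMap.id_apply, PiLp.sub_apply, tsV1_R_chart hN hk hj Λ' hsat hMh hP hc w f x, B6ScalarChartV1.boxEquiv_symm_toBox]

/-- **(2.88) FOR THE MEMBER's `∂P_□∂*` WITH THE CONSTANTS OF THE GLOBAL TORUS**: the SAME `(M₃, δ₂, C)` of gen 19's `hasMajorant_Dg_V1` (p21's
torus (2.88), functions of `d, L` only) serve every member family: for every big-block-saturated `Λ′`, `1 ≤ M_h`, `4 ≤ P_μ`, `2L ≤ R`, `M₃ ≤ L·M_h`,
every fine factor `c ≠ 0` and every weight `w`,
`HasMajorant (blkV1 hN D_□) (onFun (∂_c(tsV1).P∂_c*)) (c²(d+1)C·len(y)^{−2}·e^{−δ₂d_T(y,y′)})` on `geomT D_□`, `D_□ = famOf … Λ′`.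
[cite: Balaban1984PropagatorsII, (2.88) p.238, (2.90) p.239] -/
theorem hasMajorant_gradPdv_member (d ℓ : ℕ) (hd : 1 ≤ d + 1) (hL : Odd (ℓ + 1) ∧ 1 < ℓ + 1) :
    ∃ M₃ δ₂ C : ℝ, 0 < M₃ ∧ 0 < δ₂ ∧ 0 < C ∧
      ∀ (mt Kt : ℕ) {Mh R j : ℕ} {P' : Fin (d + 1) → ℕ} (hN : ∀ μ, N0 ℓ Mh (j + 1) P' μ = (PV d ℓ mt Kt hd hL).sitesPerDir 0)
        (hk : j + 1 ≤ mt + Kt) (hj : 1 ≤ j) (Λ' : Finset (Site (PV d ℓ mt Kt hd hL) (j + 1))),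
        (∀ Y Y' : Site (PV d ℓ mt Kt hd hL) (j + 1), bigLab Mh Y = bigLab Mh Y' → (Y ∈ Λ' ↔ Y' ∈ Λ')) →
        1 ≤ Mh → (∀ μ, 4 ≤ P' μ) → 2 * (ℓ + 1) ≤ R → M₃ ≤ ((ℓ : ℝ) + 1) * Mh →
        ∀ {c : ℝ} (hc : c ≠ 0) (w : CIdx j Λ' → ℝ),
          HasMajorant (g := geomT (famOf Mh j P' R hj Λ')) (blkV1 hN (famOf Mh j P' R hj Λ'))
            (onFun (dE c ∘ₗ (tsV1 hc Λ' w).P ∘ₗ dsE c))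
            (fun y y' => c ^ 2 * ((d : ℝ) + 1) * C / (geomT (famOf Mh j P' R hj Λ')).len y ^ 2 *
              Real.exp (-(δ₂ * (geomT (famOf Mh j P' R hj Λ')).dist y y'))) := by
  obtain ⟨M₃, δ₂, C, hM₃, hδ₂, hC, h⟩ := hasMajorant_Dg_V1 d ℓ hd hL
  refine ⟨M₃, δ₂, C, hM₃, hδ₂, hC, fun mt Kt Mh R j P' hN hk hj Λ' hsat hMh hP4 hR hM c hc w => ?_⟩
  have eP : (tsV1 hc Λ' w).P = LinearMap.id - RE (domT hN (famOf Mh j P' R hj Λ') hk) c := by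
    have e0 : (tsV1 hc Λ' w).P = LinearMap.id - (tsV1 hc Λ' w).R := rfl
    rw [e0, B6Eq2129TwoScaleV1.R_eq hc hk Λ' (w := w), domT_twoLevelT_of_sat hN hk hj Λ' hsat]
  rw [eP]
  exact h mt Kt hN (famOf Mh j P' R hj Λ') hk hMh hP4 hR hM hc

end Projection

/-! ## §4  Non-vacuity: member torus sizes meeting `hN`, both levels inhabited -/

section Witness

variable {ℓ : ℕ}

/-- **MEMBER TORUS SIZES**: with `M_h = L^a`, `P_μ = 2L^b` and `m_t + K_t = j + 2 + a + b` the member torus side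
`N₀ = L^{j+1}·L·M_h·P = 2L^{m_t+K_t}` is the V1 period. [cite: Balaban1984PropagatorsII, (2.1) p.224, p.238 (T_□), dictionary] -/
theorem N0_member (ℓ j a b mt Kt : ℕ) (hd : 1 ≤ d + 1) (hL : Odd (ℓ + 1) ∧ 1 < ℓ + 1) (hmK : mt + Kt = j + 2 + a + b) (μ : Fin (d + 1)) :
    N0 ℓ ((ℓ + 1) ^ a) (j + 1) (fun _ => 2 * (ℓ + 1) ^ b) μ = (PV d ℓ mt Kt hd hL).sitesPerDir 0 := by
  show (ℓ + 1) ^ (j + 1) * ((ℓ + 1) * ((ℓ + 1) ^ a * (2 * (ℓ + 1) ^ b))) = 2 * (ℓ + 1) ^ (mt + Kt - 0)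
  rw [Nat.sub_zero, hmK]
  ring

/-- **NON-VACUITY OF THE MEMBER PRESENTATION**: for every scale `j ≥ 1` and all exponents `a`, `b ≥ 1` there are member sizes `(m_t, K_t)` and a
member family `D_□ = twoLevelT …` on a torus which IS the V1 member torus (`hN`), with `j + 1 ≤ m_t + K_t`, `M_h = L^a ≥ 1`, `P_μ = 2L^b ≥ 4`,
and with sites at BOTH levels `j + 1` (the big block at the origin) and `j`. [cite: Balaban1984PropagatorsII, (2.89)–(2.90) p.239, (2.1) p.224] -/
theorem member_nonvacuous (d ℓ j a b R : ℕ) (hd : 1 ≤ d + 1) (hL : Odd (ℓ + 1) ∧ 1 < ℓ + 1) (hj : 1 ≤ j) (hb : 1 ≤ b) :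
    ∃ (mt Kt Mh : ℕ) (P' : Fin (d + 1) → ℕ) (ΛB : Finset (Fin (d + 1) → ℤ)),
      (∀ μ, N0 ℓ Mh (j + 1) P' μ = (PV d ℓ mt Kt hd hL).sitesPerDir 0) ∧ j + 1 ≤ mt + Kt ∧ 1 ≤ Mh ∧ (∀ μ, 4 ≤ P' μ) ∧
      Mh = (ℓ + 1) ^ a ∧
      (∃ x ∈ boxDom (N0 ℓ Mh (j + 1) P'), (twoLevelT ℓ Mh j P' R hj ΛB).lev x = j + 1) ∧
      (∃ x ∈ boxDom (N0 ℓ Mh (j + 1) P'), (twoLevelT ℓ Mh j P' R hj ΛB).lev x = j) := by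
  have hℓ : 1 ≤ ℓ := by have := hL.2; omega
  have hMh : 1 ≤ (ℓ + 1) ^ a := Nat.one_le_pow _ _ (by omega)
  have hLb : 2 ≤ (ℓ + 1) ^ b := le_trans (by omega : 2 ≤ ℓ + 1) (Nat.le_self_pow (by omega) _)
  have hP4 : ∀ μ : Fin (d + 1), 4 ≤ (fun _ : Fin (d + 1) => 2 * (ℓ + 1) ^ b) μ := fun μ => by simp only; omega
  have hP1 : ∀ μ : Fin (d + 1), 1 ≤ (fun _ : Fin (d + 1) => 2 * (ℓ + 1) ^ b) μ := fun μ => le_trans (by norm_num) (hP4 μ)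
  refine ⟨j + 2 + a + b, 0, (ℓ + 1) ^ a, fun _ => 2 * (ℓ + 1) ^ b, {0}, fun μ => N0_member ℓ j a b _ 0 hd hL rfl μ, by omega, hMh, hP4,
    rfl, ?_, ?_⟩
  · -- the origin lies in the big block labelled `0`
    refine ⟨0, ?_, ?_⟩
    · rw [mem_boxDom]; intro μ
      have := B6MultiLevelTorusOperator.one_le_N0 (ℓ := ℓ) (k := j + 1) hMh hP1 μ
      simp only [Pi.zero_apply]; exact ⟨le_rfl, by exact_mod_cast this⟩
    · have hb0 : blk (bigSide ℓ ((ℓ + 1) ^ a) (j + 1)) (0 : Fin (d + 1) → ℤ) = 0 := by funext μ; simp [blk]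
      rw [twoLevelT_lev, hb0, if_pos (Finset.mem_singleton_self _)]
  · -- the corner of the next big block in direction `0` has label `e₀ ∉ {0}`
    have hpos : 1 ≤ bigSide ℓ ((ℓ + 1) ^ a) (j + 1) := one_le_bigSide hMh _
    refine ⟨fun μ => if μ = 0 then ((bigSide ℓ ((ℓ + 1) ^ a) (j + 1) : ℕ) : ℤ) else 0, ?_, ?_⟩
    · exact B6V1TorusWitness.corner_mem_boxDom ℓ (j + 1) _ _ hMh (fun μ => le_trans (by norm_num) (hP4 μ))
    · have hb : blk (bigSide ℓ ((ℓ + 1) ^ a) (j + 1)) (fun μ : Fin (d + 1) => if μ = 0 then ((bigSide ℓ ((ℓ + 1) ^ a) (j + 1) : ℕ) : ℤ) else 0)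
          = fun μ => if μ = 0 then 1 else 0 := by
        funext μ; simp only [blk]
        have hne : ((bigSide ℓ ((ℓ + 1) ^ a) (j + 1) : ℕ) : ℤ) ≠ 0 := by exact_mod_cast (by omega : bigSide ℓ ((ℓ + 1) ^ a) (j + 1) ≠ 0)
        split_ifs
        · exact Int.ediv_self hne
        · simp
      have hnot : (fun μ : Fin (d + 1) => if μ = 0 then (1 : ℤ) else 0) ∉ ({0} : Finset (Fin (d + 1) → ℤ)) := by
        rw [Finset.mem_singleton]
        intro h
        have := congrFun h ⟨0, hd⟩; simp at this
      rw [twoLevelT_lev, hb, if_neg hnot]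

end Witness

end Literature.MathematicalPhysics.QuantumFieldTheory.Balaban1983to89.B6MemberTorusTDomainsV1

end
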